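import Literature.AlgebraicGeometry.AbelianVarieties.MarkmanDescentTwistProdTranslate
import HarnessLib

/-!
# Cancelling the discrepancy of the descent twist under `t_p`: `t_p^*[p_Â^*((P̂_{x⁻¹})^∨)] = [N′_p]` on the family
# `a^{2s}·β^{j} = 1`, `x = a^{j}·β^{2s+1}` (`p = (a, φ_Θ(β))`), and the module form `D′_s ⊗ t_p^*p_Â^*((P̂_{x⁻¹})^∨) ≅ t_p^*D′_s`

Layer `Literature/AlgebraicGeometry/AbelianVarieties`; sequel to `MarkmanDescentTwistProdTranslate` (identity (★)
`t_p^*[D′_s] = [D′_s] · [N′_p]`, `N′_p = pr_A^*(P_{φ_Θ(a)}^{⊗2s} ⊗ P_α^{⊗j}) ⊗ pr_Â^*(P̂_a^{⊗j} ⊗ P̂_{φ_Θ⁻¹(α)}^{⊗(2s+1)})`, `p = (a, α)`).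
For a principally polarised complex abelian variety `(A, Θ)` (`Â = A.dualOf Θ hΘ`, `P̂_x = linePtHat A hΘ hK x` on `Â`, the descent
twist `D′_s = descentTwist A hΘ hK s j` on `A × Â`), a complex point `p = (a, α)` of `A × Â` with `β := φ_Θ⁻¹(α)` and a complex point `x`
of `A`, this file PROVES (0 named facts, no instances), in multiplicative notation on `A(ℂ)`:

* §1 the class of the Pic⁰ slice **`T_x := p_Â^*((P̂_{x⁻¹})^∨)`** (the twist of ROW Φ-(iv) of `MarkmanPhiTranslateSnd` at `c = x`) along a
  `T`-valued point `h = (h₁, h₂)`: `Λ(x_T, h₂φ⁻¹)`, and along `h ≫ t_p`: the SAME (`P̂ ∈ Pic⁰(Â)` is translation invariant —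
  `Λ(x_T, β_T · h₂φ⁻¹) = Λ(x_T, β_T) + Λ(x_T, h₂φ⁻¹)` and `Λ` of two constant points vanishes);
* §2 under the two CANCELLATION EQUATIONS **(E1) `a^{2s} · β^{j} = 1`** and **(E2) `a^{j} · β^{2s+1} = x`** the class of `N′_p` along `h`
  collapses to `Λ(x_T, h₂φ⁻¹)` (`Λ(h₁, (a^{2s}β^{j})_T) + Λ((a^{j}β^{2s+1})_T, h₂φ⁻¹)` by the biadditivity of Mumford's `Λ`), whence the
  identity in `Ȟ¹(A × Â, 𝒪^×)` **`t_p^*[T_x] = [N′_p]`** (`pullback_prodTranslation_detClass_sndPullback_dualLinePtHat_of_cancel`, at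
  `T = A × Â`, `h = 𝟙`) and, with (★), **`[D′_s] · t_p^*[T_x] = t_p^*[D′_s]`**;
* §3 the MODULE FORMS (rank-one modules are classified by their class): `t_p^*T_x ≅ N′_p` and
  **`D′_s ⊗ t_p^*T_x ≅ t_p^*D′_s`** (`nonempty_descentTwist_tensor_pullback_iso_of_cancel`, a CHOSEN representative
  `descentTwistTensorPullbackIsoOfCancel`) — the datum under which `t_p^*` commutes with `⊗ D′_s` up to the twist `T_x`;
* §4 the family is `g`-dimensional with the `A`-coordinate FREE: for `j ≠ 0` and every `a ∈ A(ℂ)` there is `p = (a, φ_Θ(β))` with (E1)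
  (`β^{j} = a^{−2s}` is solvable: `[j]` is onto on `A(ℂ)`, `AbelianVariety.pow_surjective`), and then `x := a^{j}β^{2s+1}` satisfies (E2)
  (`exists_prodPoint_cancel`).

In Pic⁰ coordinates (`Pic⁰(A) = Â`, `Pic⁰(Â) = A`, additively): (E1) says the `A`-part `2s·φ_Θ(a) + j·α` of `N′_p` vanishes and (E2) says
its `Â`-part `j·a + (2s+1)·β` is `x`, the `Â`-part of `t_p^*T_x`. This is the class bookkeeping of the E1 step of the cell's design «(ii)+α′»
(core-w5 g11 memo, LEAD 169 (P3), director-hodge g22/g23): for `Φ_T = Φ ⋙ (⊗ D′_s)⁺` and the source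
`X₁ = (t_a × 1)^*(p₂^*P_α^∨ ⊗ t_{(x,x)}^*X₂)`, ROW Φ-(iii) + ROW Φ-(iv) give `Φ(X₁) ≅ t_p^*(T_x ⊗ Φ X₂)`, and §3 is exactly what turns
`Φ_T(X₁) = Φ(X₁) ⊗ D′_s` into `t_p^*(Φ_T X₂)`. Everything PROVED; 0 named facts; no instance, no notation. Typed for the cell `pub-hodge-ring2`
(crux 26512, socket v2's `e₁` input); a research route conditional on HC_CM, not a corollary — nothing in this file refers to it.

## References

* E. Markman, *Cycles on abelian 2n-folds of Weil type from secant sheaves on abelian n-folds*, arXiv:2502.03415 (2025), §9.3 Lemma 9.3.3 and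
  Lemma 9.3.5, p. 71 L44–70 (conjugating translations and Pic⁰-twists through `Φ̃`). [Markman2025SecantWeil]
* H. Lange, *Abelian Varieties over the Complex Numbers* (2023), §6.1.1 Lemma 6.1.3 (`P̂_x ∈ Pic⁰(X̂)`), §2.3. [Lange2023AbelianVarietiesComplex]
* D. Mumford, *Abelian Varieties* (1970), §6 Cor. 3–4, §8 (the pairing `Λ(L)`, `Pic⁰`), §6 App. 3 and §7 (isogenies are onto). [MumfordAV1970]
* U. Görtz, T. Wedhorn, *Algebraic Geometry II* (2023), Def./Rem. 27.1 (p. 799), Prop. 27.186–27.187. [GortzWedhorn2023]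
* R. Hartshorne, *Algebraic Geometry* (1977), II Ex. 6.8, III Ex. 4.5. [Hartshorne1977]
-/

noncomputable section

-- `TopCat.Presheaf`/`Scheme.Modules` are not reducible (as in Mathlib's `AlgebraicGeometry/Modules/Sheaf.lean`).
set_option backward.isDefEq.respectTransparency false

open CategoryTheory CategoryTheory.Limits AlgebraicGeometry MonoidalCategory CartesianMonoidalCategory
open AlgebraicGeometry.Scheme.Modules

namespace Literature.AlgebraicGeometry.AbelianVarieties

open Literature.AlgebraicGeometry.Motives Literature.AlgebraicGeometry.Modules
open scoped MonObj

variable (A : AbelianVariety ℂ) {Θ : CartierDivisor A.X.left} (hΘ : Θ.IsAmple) (hK : A.KTheta Θ = ⊥)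

/-! ### §0 Bookkeeping -/

section Bookkeeping

/-- `(f ≫ g)^* = f^* ∘ g^*` on `Ȟ¹(–, 𝒪^×)` (the tree's `CechPic.pullback_comp` of `Modules/UnitCocyclePresented`, outside this file's import
closure; re-proved privately as in `MarkmanDescentTwistProdTranslate`). [cite: Hartshorne1977, II Ex. 6.8 (functoriality of f^* on Pic)] -/
private theorem cechPic_pullback_comp' {X Y Z : Scheme.{0}} (f : X ⟶ Y) (g : Y ⟶ Z) (c : CechPic Z) :
    CechPic.pullback (f ≫ g) c = CechPic.pullback f (CechPic.pullback g c) := by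
  obtain ⟨c, rfl⟩ := CechPic.mk_surjective c
  rw [CechPic.pullback_mk, CechPic.pullback_mk, CechPic.pullback_mk]
  refine CechPic.sound (UnitCocycle.equiv_of_eq _ _
    (fun x => f ⁻¹ᵁ (g ⁻¹ᵁ c.U (g.base (f.base x)))) (fun x => c.mem (g.base (f.base x)))
    (fun x => le_of_eq rfl) (fun x => le_rfl) fun x y V hx hy => ?_)
  change (g.appLE _ _ _ ≫ f.appLE _ V _) (c.g _ _ _ _ _) = (f ≫ g).appLE _ V _ (c.g _ _ _ _ _)
  rw [Scheme.Hom.appLE_comp_appLE]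
  rfl

/-- `g ≫ toSpecOver S = toSpecOver T`. [cite: GortzWedhorn2023, Def./Rem. 27.1 (p. 799)] -/
private theorem comp_toSpecOver' {T S : SchemeOver ℂ} (g : T ⟶ S) : g ≫ toSpecOver S = toSpecOver T := by
  ext1
  rw [Over.comp_left, toSpecOver_left, toSpecOver_left, Over.w]

end Bookkeeping

/-! ### §1 The class of `T_x = p_Â^*((P̂_{x⁻¹})^∨)` along `h` and along `h ≫ t_p` -/

section Slice

variable (p : (A.prod (A.dualOf Θ hΘ)).Points ℂ) (x : A.Points ℂ) {T : SchemeOver ℂ} [IsIntegral T.left]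

/-- **The class of `T_x = p_Â^*((P̂_{x⁻¹})^∨)` along a `T`-valued point `h = (h₁, h₂)` of `A × Â` is `Λ(x_T, h₂φ⁻¹)`**
(`[P̂_{x⁻¹}]` along `h₂` is `Λ((x⁻¹)_T, h₂φ⁻¹)`, the dual inverts, `Λ(u⁻¹, v) = −Λ(u, v)`). [cite: Lange2023AbelianVarietiesComplex, §6.1.1 Lemma 6.1.3]
[cite: MumfordAV1970, §8 (the pairing Λ(L))] -/
theorem ofMul_pullback_detClass_sndPullback_dualLinePtHat (h : T ⟶ A.X ⊗ (A.dualOf Θ hΘ).X) :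
    Additive.ofMul (CechPic.pullback h.left
        (detClass ((isFiniteLocallyFree_dual (isFiniteLocallyFree_linePtHat A hΘ hK x⁻¹)).pullback
          (snd A.X (A.dualOf Θ hΘ).X).left))) =
      AbelianVariety.Lam Θ (cechCl T.left) (toSpecOver T ≫ x) (h ≫ snd _ _ ≫ phiThetaInv A hΘ hK) := by
  have hP := isFiniteLocallyFree_linePtHat A hΘ hK x⁻¹
  rw [detClass_pullback _ (isFiniteLocallyFree_dual hP), detClass_dual hP, map_inv, map_inv, ← cechPic_pullback_comp',
    ← Over.comp_left, ofMul_inv, ofMul_pullback_detClass_linePtHat, GrpObj.comp_inv, Lam_inv_left, neg_neg, Category.assoc]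

/-- **The class of `T_x` along `h ≫ t_p` equals its class along `h`** (`P̂_{x⁻¹} ∈ Pic⁰(Â)` is translation invariant: under `h ↦ h ≫ t_p`,
`h₂φ⁻¹ ↦ β_T · h₂φ⁻¹` with `β = φ_Θ⁻¹(α)`, and `Λ(x_T, β_T · h₂φ⁻¹) = Λ(x_T, β_T) + Λ(x_T, h₂φ⁻¹)`, `Λ(x_T, β_T) = 0`).
[cite: Lange2023AbelianVarietiesComplex, §6.1.1 (P_x ∈ Pic⁰(X̂))] [cite: MumfordAV1970, §6 Cor. 4 and §8] -/
theorem ofMul_pullback_prodTranslation_detClass_sndPullback_dualLinePtHat (h : T ⟶ A.X ⊗ (A.dualOf Θ hΘ).X) :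
    Additive.ofMul (CechPic.pullback (h ≫ prodTranslation A (A.dualOf Θ hΘ) p).left
        (detClass ((isFiniteLocallyFree_dual (isFiniteLocallyFree_linePtHat A hΘ hK x⁻¹)).pullback
          (snd A.X (A.dualOf Θ hΘ).X).left))) =
      AbelianVariety.Lam Θ (cechCl T.left) (toSpecOver T ≫ x) (h ≫ snd _ _ ≫ phiThetaInv A hΘ hK) := by
  have hadd := cechCl_add T.left
  have heq := linEquiv_iff_cechCl_eq T.left
  have hcube := A.cubicalStructure_linEquiv_holds
  -- the substitution `h ↦ h ≫ t_p`: `h₂ φ⁻¹ ↦ β_T · (h₂ φ⁻¹)`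
  have h₂ : (h ≫ prodTranslation A (A.dualOf Θ hΘ) p) ≫ snd _ _ ≫ phiThetaInv A hΘ hK =
      (toSpecOver T ≫ (p ≫ snd _ _) ≫ phiThetaInv A hΘ hK) * (h ≫ snd _ _ ≫ phiThetaInv A hΘ hK) := by
    rw [Category.assoc, ← Category.assoc (prodTranslation _ _ _) (snd _ _), prodTranslation_comp_snd, Category.assoc (snd _ _),
      translation_comp_phiThetaInv, ← Category.assoc (snd _ _), AbelianVariety.comp_translation_eq_mul, MonObj.comp_mul,
      ← Category.assoc h (toSpecOver _), comp_toSpecOver', Category.assoc]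
  rw [ofMul_pullback_detClass_sndPullback_dualLinePtHat, h₂, AbelianVariety.Lam_mul_right hadd heq hcube, Lam_const_const, zero_add]

end Slice

/-! ### §2 The class of `N′_p` under the cancellation equations, and `t_p^*[T_x] = [N′_p]` -/

section Cancel

variable (s j : ℕ) (p : (A.prod (A.dualOf Θ hΘ)).Points ℂ) (x : A.Points ℂ) {T : SchemeOver ℂ} [IsIntegral T.left]

/-- **Under (E1) `a^{2s}·β^{j} = 1` and (E2) `a^{j}·β^{2s+1} = x` the class of `N′_p` along `h = (h₁, h₂)` is `Λ(x_T, h₂φ⁻¹)`**: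
`2s•Λ(h₁, a_T) + j•Λ(h₁, β_T) = Λ(h₁, (a^{2s}β^{j})_T) = Λ(h₁, 1) = 0` and `j•Λ(a_T, h₂φ⁻¹) + (2s+1)•Λ(β_T, h₂φ⁻¹) = Λ((a^{j}β^{2s+1})_T, h₂φ⁻¹)`
(biadditivity of `Λ` — the cubical structure). [cite: Markman2025SecantWeil, §9.3 Lemma 9.3.3 p. 71 L54–70] [cite: MumfordAV1970, §6 Cor. 3–4 and §8] -/
theorem ofMul_pullback_detClass_descentTwistProdTranslate_of_cancel
    (h₁ : (p ≫ fst _ _) ^ (2 * s) * ((p ≫ snd _ _) ≫ phiThetaInv A hΘ hK) ^ j = 1)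
    (h₂ : (p ≫ fst _ _) ^ j * ((p ≫ snd _ _) ≫ phiThetaInv A hΘ hK) ^ (2 * s + 1) = x) (h : T ⟶ A.X ⊗ (A.dualOf Θ hΘ).X) :
    Additive.ofMul (CechPic.pullback h.left (detClass (isFiniteLocallyFree_descentTwistProdTranslate A hΘ hK s j p))) =
      AbelianVariety.Lam Θ (cechCl T.left) (toSpecOver T ≫ x) (h ≫ snd _ _ ≫ phiThetaInv A hΘ hK) := by
  have hadd := cechCl_add T.left
  have heq := linEquiv_iff_cechCl_eq T.left
  have hcube := A.cubicalStructure_linEquiv_holds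
  -- the two constant points `a_T`, `β_T` multiply as `a`, `β` do
  have hA : (toSpecOver T ≫ p ≫ fst _ _) ^ (2 * s) * (toSpecOver T ≫ (p ≫ snd _ _) ≫ phiThetaInv A hΘ hK) ^ j = 1 := by
    rw [← MonObj.comp_pow (p ≫ fst _ _), ← MonObj.comp_pow ((p ≫ snd _ _) ≫ phiThetaInv A hΘ hK), ← MonObj.comp_mul, h₁,
      MonObj.comp_one]
  have hB : (toSpecOver T ≫ p ≫ fst _ _) ^ j * (toSpecOver T ≫ (p ≫ snd _ _) ≫ phiThetaInv A hΘ hK) ^ (2 * s + 1) =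
      toSpecOver T ≫ x := by
    rw [← MonObj.comp_pow (p ≫ fst _ _), ← MonObj.comp_pow ((p ≫ snd _ _) ≫ phiThetaInv A hΘ hK), ← MonObj.comp_mul, h₂]
  rw [ofMul_pullback_detClass_descentTwistProdTranslate, ← AbelianVariety.Lam_pow_right hadd heq hcube,
    ← AbelianVariety.Lam_pow_right hadd heq hcube, ← AbelianVariety.Lam_mul_right hadd heq hcube, hA,
    ← AbelianVariety.Lam_pow_left hadd heq hcube, ← AbelianVariety.Lam_pow_left hadd heq hcube,
    ← AbelianVariety.Lam_mul_left hadd heq hcube, hB, AbelianVariety.Lam_comm _ (1 : T ⟶ A.X),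
    AbelianVariety.Lam_one_left heq hadd, zero_add]

/-- **THE CANCELLATION IDENTITY IN `Ȟ¹(A × Â, 𝒪^×)`: `t_p^*[T_x] = [N′_p]`** under (E1), (E2) (`T_x = p_Â^*((P̂_{x⁻¹})^∨)`; both classes are
`Λ(x, p₂φ⁻¹)` along the identity point of the integral scheme `A × Â`; `t_p` is the scheme automorphism `prodTranslationSchemeIso A Â p`).
[cite: Markman2025SecantWeil, §9.3 Lemma 9.3.3 and Lemma 9.3.5 (p. 71)] [cite: Lange2023AbelianVarietiesComplex, §6.1.1 Lemma 6.1.3] -/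
theorem pullback_prodTranslation_detClass_sndPullback_dualLinePtHat_of_cancel
    (h₁ : (p ≫ fst _ _) ^ (2 * s) * ((p ≫ snd _ _) ≫ phiThetaInv A hΘ hK) ^ j = 1)
    (h₂ : (p ≫ fst _ _) ^ j * ((p ≫ snd _ _) ≫ phiThetaInv A hΘ hK) ^ (2 * s + 1) = x) :
    CechPic.pullback (prodTranslationSchemeIso A (A.dualOf Θ hΘ) p).hom
        (detClass ((isFiniteLocallyFree_dual (isFiniteLocallyFree_linePtHat A hΘ hK x⁻¹)).pullback
          (snd A.X (A.dualOf Θ hΘ).X).left)) =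
      detClass (isFiniteLocallyFree_descentTwistProdTranslate A hΘ hK s j p) := by
  have h := ofMul_pullback_prodTranslation_detClass_sndPullback_dualLinePtHat A hΘ hK p x (𝟙 (A.X ⊗ (A.dualOf Θ hΘ).X))
  rw [← ofMul_pullback_detClass_descentTwistProdTranslate_of_cancel A hΘ hK s j p x h₁ h₂ (𝟙 _), Category.id_comp,
    Over.id_left, CechPic.pullback_id_apply] at h
  exact Additive.ofMul.injective h

/-- **`[D′_s] · t_p^*[T_x] = t_p^*[D′_s]`** under (E1), (E2) — identity (★) `t_p^*[D′_s] = [D′_s]·[N′_p]` with `[N′_p] = t_p^*[T_x]`.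
[cite: Markman2025SecantWeil, §9.3 Lemma 9.3.3 and Lemma 9.3.5 (p. 71)] -/
theorem detClass_descentTwist_mul_pullback_prodTranslation_of_cancel
    (h₁ : (p ≫ fst _ _) ^ (2 * s) * ((p ≫ snd _ _) ≫ phiThetaInv A hΘ hK) ^ j = 1)
    (h₂ : (p ≫ fst _ _) ^ j * ((p ≫ snd _ _) ≫ phiThetaInv A hΘ hK) ^ (2 * s + 1) = x) :
    detClass (isFiniteLocallyFree_descentTwist A hΘ hK s j) *
        CechPic.pullback (prodTranslationSchemeIso A (A.dualOf Θ hΘ) p).hom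
          (detClass ((isFiniteLocallyFree_dual (isFiniteLocallyFree_linePtHat A hΘ hK x⁻¹)).pullback
            (snd A.X (A.dualOf Θ hΘ).X).left)) =
      CechPic.pullback (prodTranslationSchemeIso A (A.dualOf Θ hΘ) p).hom (detClass (isFiniteLocallyFree_descentTwist A hΘ hK s j)) := by
  rw [pullback_prodTranslation_detClass_sndPullback_dualLinePtHat_of_cancel A hΘ hK s j p x h₁ h₂,
    pullback_prodTranslation_detClass_descentTwist]

end Cancel

/-! ### §3 Module forms -/

section ModuleForm

variable (s j : ℕ) (p : (A.prod (A.dualOf Θ hΘ)).Points ℂ) (x : A.Points ℂ)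

/-- **`t_p^*T_x ≅ N′_p`** under (E1), (E2) (rank-one modules are classified by their class, `nonempty_iso_iff_detClass_eq`).
[cite: Markman2025SecantWeil, §9.3 Lemma 9.3.3 and Lemma 9.3.5 (p. 71)] [cite: Hartshorne1977, III Ex. 4.5] -/
theorem nonempty_pullback_prodTranslation_sndPullback_dualLinePtHat_iso_of_cancel
    (h₁ : (p ≫ fst _ _) ^ (2 * s) * ((p ≫ snd _ _) ≫ phiThetaInv A hΘ hK) ^ j = 1)
    (h₂ : (p ≫ fst _ _) ^ j * ((p ≫ snd _ _) ≫ phiThetaInv A hΘ hK) ^ (2 * s + 1) = x) :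
    Nonempty ((Scheme.Modules.pullback (prodTranslationSchemeIso A (A.dualOf Θ hΘ) p).hom).obj
        ((Scheme.Modules.pullback (snd A.X (A.dualOf Θ hΘ).X).left).obj (Modules.dual (linePtHat A hΘ hK x⁻¹))) ≅
      descentTwistProdTranslate A hΘ hK s j p) := by
  have hL := (isFiniteLocallyFree_dual (isFiniteLocallyFree_linePtHat A hΘ hK x⁻¹)).pullback (snd A.X (A.dualOf Θ hΘ).X).left
  have hL₁ : HasRank ((Scheme.Modules.pullback (snd A.X (A.dualOf Θ hΘ).X).left).obj (Modules.dual (linePtHat A hΘ hK x⁻¹))) 1 :=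
    hasRank_pullback _ (hasRank_dual (hasRank_linePtHat A hΘ hK x⁻¹))
  refine (nonempty_iso_iff_detClass_eq (hasRank_pullback _ hL₁) (hasRank_descentTwistProdTranslate A hΘ hK s j p) (hL.pullback _)
    (isFiniteLocallyFree_descentTwistProdTranslate A hΘ hK s j p)).2 ?_
  rw [detClass_pullback _ hL, pullback_prodTranslation_detClass_sndPullback_dualLinePtHat_of_cancel A hΘ hK s j p x h₁ h₂]

/-- **MODULE FORM OF THE CANCELLATION: `D′_s ⊗ t_p^*T_x ≅ t_p^*D′_s`** under (E1), (E2), `T_x = p_Â^*((P̂_{x⁻¹})^∨)` — the datum under which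
`(T_x ⊗ –) ⋙ t_p^* ⋙ (D′_s ⊗ –) ≅ (D′_s ⊗ –) ⋙ t_p^*` on `Mod 𝒪_{A×Â}`. Objectwise; no normalisation of the isomorphism is asserted.
[cite: Markman2025SecantWeil, §9.3 Lemma 9.3.3 and Lemma 9.3.5 (p. 71)] [cite: Hartshorne1977, III Ex. 4.5] -/
theorem nonempty_descentTwist_tensor_pullback_iso_of_cancel
    (h₁ : (p ≫ fst _ _) ^ (2 * s) * ((p ≫ snd _ _) ≫ phiThetaInv A hΘ hK) ^ j = 1)
    (h₂ : (p ≫ fst _ _) ^ j * ((p ≫ snd _ _) ≫ phiThetaInv A hΘ hK) ^ (2 * s + 1) = x) :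
    Nonempty (tensorObj (descentTwist A hΘ hK s j)
        ((Scheme.Modules.pullback (prodTranslationSchemeIso A (A.dualOf Θ hΘ) p).hom).obj
          ((Scheme.Modules.pullback (snd A.X (A.dualOf Θ hΘ).X).left).obj (Modules.dual (linePtHat A hΘ hK x⁻¹)))) ≅
      (Scheme.Modules.pullback (prodTranslationSchemeIso A (A.dualOf Θ hΘ) p).hom).obj (descentTwist A hΘ hK s j)) := by
  have hD := isFiniteLocallyFree_descentTwist A hΘ hK s j
  have hD₁ := hasRank_descentTwist A hΘ hK s j
  have hL := (isFiniteLocallyFree_dual (isFiniteLocallyFree_linePtHat A hΘ hK x⁻¹)).pullback (snd A.X (A.dualOf Θ hΘ).X).left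
  have hL₁ : HasRank ((Scheme.Modules.pullback (snd A.X (A.dualOf Θ hΘ).X).left).obj (Modules.dual (linePtHat A hΘ hK x⁻¹))) 1 :=
    hasRank_pullback _ (hasRank_dual (hasRank_linePtHat A hΘ hK x⁻¹))
  refine (nonempty_iso_iff_detClass_eq (hasRank_tensorObj_one hD₁ (hasRank_pullback _ hL₁)) (hasRank_pullback _ hD₁)
    (isFiniteLocallyFree_tensorObj _ _ hD (hL.pullback _)) (hD.pullback _)).2 ?_
  rw [detClass_tensorObj_of_hasRank_one hD₁ (hasRank_pullback _ hL₁) hD (hL.pullback _), detClass_pullback _ hL, detClass_pullback _ hD,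
    detClass_descentTwist_mul_pullback_prodTranslation_of_cancel A hΘ hK s j p x h₁ h₂]

/-- A CHOSEN isomorphism `D′_s ⊗ t_p^*T_x ≅ t_p^*D′_s` under (E1), (E2). [cite: Markman2025SecantWeil, §9.3 Lemma 9.3.3 and Lemma 9.3.5 (p. 71)] -/
def descentTwistTensorPullbackIsoOfCancel
    (h₁ : (p ≫ fst _ _) ^ (2 * s) * ((p ≫ snd _ _) ≫ phiThetaInv A hΘ hK) ^ j = 1)
    (h₂ : (p ≫ fst _ _) ^ j * ((p ≫ snd _ _) ≫ phiThetaInv A hΘ hK) ^ (2 * s + 1) = x) :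
    tensorObj (descentTwist A hΘ hK s j)
        ((Scheme.Modules.pullback (prodTranslationSchemeIso A (A.dualOf Θ hΘ) p).hom).obj
          ((Scheme.Modules.pullback (snd A.X (A.dualOf Θ hΘ).X).left).obj (Modules.dual (linePtHat A hΘ hK x⁻¹)))) ≅
      (Scheme.Modules.pullback (prodTranslationSchemeIso A (A.dualOf Θ hΘ) p).hom).obj (descentTwist A hΘ hK s j) :=
  (nonempty_descentTwist_tensor_pullback_iso_of_cancel A hΘ hK s j p x h₁ h₂).some

end ModuleForm

/-! ### §4 The family `p = (a, φ_Θ(β))`, `a^{2s}·β^{j} = 1`: the `A`-coordinate is free -/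

section Family

variable (s j : ℕ)

/-- **For `j ≠ 0` and EVERY `a ∈ A(ℂ)` there is a point `p = (a, φ_Θ(β))` of `A × Â` with (E1) `a^{2s} · β^{j} = 1`** (`[j]` is onto on
`A(ℂ)`, so `β^{j} = (a^{2s})⁻¹` is solvable; `φ_Θ(β) ≫ φ_Θ⁻¹ = β`). With `x := a^{j}·β^{2s+1}`, (E2) then holds by definition.
[cite: GortzWedhorn2023, Prop. 27.186 and Prop. 27.187] [cite: MumfordAV1970, §6 App. 3 and §7] -/
theorem exists_prodPoint_cancel (hj : j ≠ 0) (a : A.Points ℂ) :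
    ∃ p : (A.prod (A.dualOf Θ hΘ)).Points ℂ, p ≫ fst _ _ = a ∧
      (p ≫ fst _ _) ^ (2 * s) * ((p ≫ snd _ _) ≫ phiThetaInv A hΘ hK) ^ j = 1 := by
  obtain ⟨β, hβ⟩ := A.pow_surjective j hj (a ^ (2 * s))⁻¹
  refine ⟨lift a (β ≫ phiThetaOver A hΘ), lift_fst _ _, ?_⟩
  rw [lift_fst, lift_snd, Category.assoc, phiTheta_comp_phiThetaInv, Category.comp_id]
  change a ^ (2 * s) * (fun P : A.Points ℂ => P ^ j) β = 1
  rw [hβ, mul_inv_cancel]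

end Family

end Literature.AlgebraicGeometry.AbelianVarieties

end
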